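import Summits.QuantumFields.BalabanUV.T4Continuum.Support.MinimalActionRate

/-!
# T⁴ programme, node NE3 (η-rate of the minimisers) — THE ACTION SANDWICH, part 4: NON-VACUITY
# (the flat datum satisfies `SandwichData`, so `actionRate_of_sandwichData` has an honest instance)

Sixteenth generation of the NE3 prover lineage P1 of the cell `pub-balaban` (unit `b2b-balaban-t4-ne3-p1`, OWNER of
`BINDER-OWNERS.md` row NE3), file 4 of the «action sandwich» series (parts 1–3: `MinimalActionLevels`,
`MinimalActionSandwich`, `MinimalActionRate`).  Part 3's theorem `actionRate_of_sandwichData` turns the hypothesis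
shape `SandwichData 𝒞 L N b g V` (minimisers of every run exist, are `Regular`, average into the coarser class, and
admit regular refinements) into `T4EtaRateMin.ActionRate … (wallConstNA(d,L)(g + b³)/L²) (L^{−2})`.  THIS FILE certifies
that the shape is JOINTLY SATISFIABLE by exhibiting the trivial instance: the FLAT configuration `U ≡ 1` as datum, with
the singleton class family `flatClass k = {1}` — the flat configuration is its own `k`-fold average at every level
(`avgIter_flatCfg`, from the tree's `bavg_flat`), its level actions vanish (`levelAction_flatCfg`, `wt 1 = 0`), its flux
and flux gradient vanish (`flux_flatCfg`, `gradFluxSq_flatCfg`, `mlog 1 = 0`), so it is `Regular d L N b g j` for all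
`b, g ≥ 0` (`regular_flatCfg`), it is the unique admissible configuration and the minimiser of every run
(`isMinimiser_flatCfg`, `eq_flatCfg_of_isMinimiser`), whence **`sandwichData_flatCfg`** and **`actionRate_flatClass`**
(the minimal actions are all `0`: `minAct_flatClass`).  It also records that the flat configuration lies in every
small-field class `sfClass d L N ε k`, `ε ≥ 0` (`flatCfg_mem_sfClass`) and minimises every run there
(`isMinimiser_sfClass_flatCfg`), the non-trivial classes of part 3 §4.
Nothing here is an estimate; the instance is TRIVIAL by design (non-vacuity, not content).

HONEST FRAMING.  Finite-T⁴ ultraviolet bookkeeping about MINIMISERS (rung (B)+1 of the cell's ladder); no conditional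
of the cell (`BetaPertH`, (B), (B^μ)) is used or hidden; nothing bears on infinite volume, a mass gap, or the Clay
problem; NE3 is NOT proved.  ABSOLUTE RULE of the cell kept: no printed sentence is a hypothesis; inputs are
kernel-proved tree modules only; no `sorry`, no axioms beyond Mathlib's.  PLACEMENT (human rule 2026-08-19): cell work
under `Summits/QuantumFields/BalabanUV/`; imports `Support.MinimalActionRate` only; moves nothing.  Records:
`t4/T4-EST-U1b-OSC.md` v1.34, `t4/T4-EST-NE3-P1.md` v2.33 of the cell `pub-balaban`.
-/

set_option autoImplicit false

open scoped BigOperators Matrix Matrix.Norms.L2Operator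
open NormedSpace Finset

namespace Summit.QuantumFields.BalabanUV.T4Continuum.MinimalActionWitness

open Literature.MathematicalPhysics.QuantumFieldTheory.Balaban1983to89
open B7Prop1Explicit B7Prop2Explicit MatrixLog UnitaryModel
open T4AveragingDeficitWall hiding Site Plane Plaq Bond
open T4AveragingDeficitWallBoundary (IsPeriodicCfg periodBox)
open T4AveragingDeficitNonAbelian (wallConstNA)
open T4EtaRateMin (Readings ActionRate)
open MinimalActionLevels MinimalActionSandwich MinimalActionRate

noncomputable section

variable {d : ℕ} {n : Type*} [Fintype n] [DecidableEq n]

local notation "𝕄" => Matrix n n ℂ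
local notation "Site" => B7Prop1Explicit.Site

/-! ## §1 The flat configuration: actions, averages, flux -/

/-- The flat configuration `U ≡ 1`. [folklore] -/
def flatCfg : Site d → Fin d → 𝕄ˣ := fun _ _ => 1

/-- Its plaquette variables are `1` (tree `hol_flat`). [folklore] -/
theorem fhol_flatCfg (p : T4AveragingDeficitWall.Plaq d) : fhol (flatCfg : Site d → Fin d → 𝕄ˣ) p = 1 :=
  hol_flat _ _

/-- Its fine Wilson action vanishes on every window. [folklore] -/
theorem fineAction_flatCfg [Nonempty n] (W : Finset (T4AveragingDeficitWall.Plaq d)) :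
    fineAction (flatCfg : Site d → Fin d → 𝕄ˣ) W = 0 := by
  unfold fineAction
  exact Finset.sum_eq_zero fun p _ => by rw [fhol_flatCfg, wt_one]

/-- Its level-`k` action vanishes. [folklore] -/
theorem levelAction_flatCfg [Nonempty n] (L N k : ℕ) : levelAction d L N k (flatCfg : Site d → Fin d → 𝕄ˣ) = 0 := by
  unfold levelAction
  rw [fineAction_flatCfg, mul_zero]

/-- Its rescaled one-step average is flat (tree `bavg_flat`). [folklore] -/
theorem rescale_bavg_flatCfg (L : ℕ) : rescale L (bavg L (flatCfg : Site d → Fin d → 𝕄ˣ)) = flatCfg := by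
  unfold flatCfg
  rw [bavg_flat]
  rfl

/-- Hence it is its own `k`-fold average at every level. [folklore] -/
theorem avgIter_flatCfg (L : ℕ) : ∀ k : ℕ, avgIter L (flatCfg : Site d → Fin d → 𝕄ˣ) k = flatCfg
  | 0 => rfl
  | k + 1 => by rw [avgIter_succ, avgIter_flatCfg L k, rescale_bavg_flatCfg]

/-- Its flux vanishes (`mlog 1 = 0`). [folklore] -/
theorem flux_flatCfg (p : T4AveragingDeficitWall.Plaq d) : flux (flatCfg : Site d → Fin d → 𝕄ˣ) p = 0 := by
  unfold flux
  rw [fhol_flatCfg, Units.val_one, mlog_one]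

/-- Hence its flux-gradient energy vanishes on every site set. [folklore] -/
theorem gradFluxSq_flatCfg (S : Finset (Site d)) : gradFluxSq (flatCfg : Site d → Fin d → 𝕄ˣ) S = 0 := by
  unfold gradFluxSq
  refine Finset.sum_eq_zero fun x _ => Finset.sum_eq_zero fun κ _ => Finset.sum_eq_zero fun π _ => ?_
  have : covGrad (flatCfg : Site d → Fin d → 𝕄ˣ) (flux flatCfg) x κ π = 0 := by
    unfold covGrad Ad
    simp only [flux_flatCfg, mul_zero, zero_mul, sub_zero]
  rw [this, norm_zero, zero_pow two_ne_zero]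

/-- It is periodic with every period. [folklore] -/
theorem isPeriodicCfg_flatCfg (P : ℤ) : IsPeriodicCfg (flatCfg : Site d → Fin d → 𝕄ˣ) P := fun _ _ _ => rfl

/-- It is `Regular d L N b g j` for all `b, g ≥ 0`. [folklore] -/
theorem regular_flatCfg (L N j : ℕ) {b g : ℝ} (hb : 0 ≤ b) (hg : 0 ≤ g) :
    Regular d L N b g j (flatCfg : Site d → Fin d → 𝕄ˣ) where
  unitary := (flat_mem_classes (d := d) (n := n) (div_nonneg hb (by positivity) :
    (0 : ℝ) ≤ b / ((L : ℝ) ^ j) ^ 2)).1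
  periodic := isPeriodicCfg_flatCfg _
  small := (flat_mem_classes (d := d) (n := n) (div_nonneg hb (by positivity) :
    (0 : ℝ) ≤ b / ((L : ℝ) ^ j) ^ 2)).2
  grad := by rw [gradFluxSq_flatCfg]; positivity

/-! ## §2 The singleton class family and the flat instance of `SandwichData` -/

/-- The singleton class family `{1}` at every level. [folklore] -/
def flatClass : ℕ → Set (Site d → Fin d → 𝕄ˣ) := fun _ => {flatCfg}

/-- The flat configuration is admissible for every run of the flat datum. [folklore] -/
theorem flatCfg_mem_admissible (L k : ℕ) :
    (flatCfg : Site d → Fin d → 𝕄ˣ) ∈ admissible flatClass L k flatCfg :=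
  ⟨Set.mem_singleton _, avgIter_flatCfg L k⟩

/-- It minimises every run (over the singleton class every admissible configuration is flat). [folklore] -/
theorem isMinimiser_flatCfg (L N k : ℕ) :
    IsMinimiser d flatClass L N k (flatCfg : Site d → Fin d → 𝕄ˣ) flatCfg where
  mem := flatCfg_mem_admissible L k
  le := fun U' hU' => by rw [Set.mem_singleton_iff.mp hU'.1]

/-- … and every minimiser is the flat configuration. [folklore] -/
theorem eq_flatCfg_of_isMinimiser {L N k : ℕ} {U : Site d → Fin d → 𝕄ˣ}
    (h : IsMinimiser d flatClass L N k (flatCfg : Site d → Fin d → 𝕄ˣ) U) : U = flatCfg :=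
  Set.mem_singleton_iff.mp h.mem.1

/-- **NON-VACUITY OF `SandwichData`**: the flat datum with the singleton class family satisfies it for all `b, g ≥ 0`.
[folklore] -/
theorem sandwichData_flatCfg (L N : ℕ) {b g : ℝ} (hb : 0 ≤ b) (hg : 0 ≤ g) :
    SandwichData d flatClass L N b g (flatCfg : Site d → Fin d → 𝕄ˣ) where
  exists_minimiser := fun k => ⟨flatCfg, isMinimiser_flatCfg L N k⟩
  regular := fun k U hU => by rw [eq_flatCfg_of_isMinimiser hU]; exact regular_flatCfg L N (k + 1) hb hg
  avg_mem := fun k U hU => by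
    rw [eq_flatCfg_of_isMinimiser hU, rescale_bavg_flatCfg]
    exact Set.mem_singleton _
  refine := fun k U hU =>
    ⟨flatCfg, Set.mem_singleton _, by rw [rescale_bavg_flatCfg, eq_flatCfg_of_isMinimiser hU],
      regular_flatCfg L N (k + 1) hb hg⟩

/-- The minimal actions of the flat datum vanish. [folklore] -/
theorem minAct_flatClass [Nonempty n] (L N k : ℕ) :
    minAct d flatClass L N k (flatCfg : Site d → Fin d → 𝕄ˣ) = 0 := by
  rw [(isMinimiser_flatCfg (d := d) (n := n) L N k).minAct_eq, levelAction_flatCfg]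

/-- **NON-VACUITY OF THE RATE THEOREM**: `actionRate_of_sandwichData` instantiated at the flat datum — an honest (if
trivial) inhabitant of `ActionRate (minActReadings … loc) (wallConstNA(d,L)(g + b³)/L²) (L^{−2})` for every supplied local
reading `loc`. [folklore] -/
theorem actionRate_flatClass [Nonempty n] {L N : ℕ} (hL : 1 ≤ L) (hN : 1 ≤ N) {b g : ℝ} (hb : 0 ≤ b)
    (hbs : 512 * (d + 1) * (d + 4) * (L : ℝ) ^ 2 * b ≤ 1) (hg : 0 ≤ g)
    {X : Type*} (loc : ℕ → (Site d → Fin d → 𝕄ˣ) → X → ℝ) :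
    ActionRate (minActReadings d flatClass L N {(flatCfg : Site d → Fin d → 𝕄ˣ)} loc)
      (wallConstNA d L * (g + b ^ 3) / (L : ℝ) ^ 2) (((L : ℝ) ^ 2)⁻¹) :=
  actionRate_of_sandwichData hL hN hb hbs (fun V hV => by
    rw [Set.mem_singleton_iff.mp hV]; exact sandwichData_flatCfg L N hb hg) loc

/-! ## §3 The flat configuration in the small-field classes of part 3 -/

/-- The flat configuration lies in every small-field class `sfClass d L N ε k`, `ε ≥ 0`. [folklore] -/
theorem flatCfg_mem_sfClass (L N : ℕ) {ε : ℝ} (hε : 0 ≤ ε) (k : ℕ) :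
    (flatCfg : Site d → Fin d → 𝕄ˣ) ∈ sfClass d L N ε k :=
  ⟨(flat_mem_classes (d := d) (n := n) (div_nonneg hε (by positivity) : (0 : ℝ) ≤ ε / ((L : ℝ) ^ k) ^ 2)).1,
    isPeriodicCfg_flatCfg _,
    (flat_mem_classes (d := d) (n := n) (div_nonneg hε (by positivity) : (0 : ℝ) ≤ ε / ((L : ℝ) ^ k) ^ 2)).2⟩

/-- … and minimises every run of the flat datum there (its action is `0`, every `U(N)`-valued action is `≥ 0`).
[folklore] -/
theorem isMinimiser_sfClass_flatCfg [Nonempty n] {L : ℕ} (hL : 1 ≤ L) (N : ℕ) {ε : ℝ} (hε : 0 ≤ ε) (k : ℕ) :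
    IsMinimiser d (sfClass d L N ε) L N k (flatCfg : Site d → Fin d → 𝕄ˣ) flatCfg where
  mem := ⟨flatCfg_mem_sfClass L N hε k, avgIter_flatCfg L k⟩
  le := fun U' hU' => by
    rw [levelAction_flatCfg]
    exact levelAction_nonneg L N k hL hU'.1.1

end

end Summit.QuantumFields.BalabanUV.T4Continuum.MinimalActionWitness
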